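import Literature.Probability.Distributions.BrascampLiebCalculus
import HarnessLib

/-!
# Normalised densities and disintegration along the first coordinate

`Literature/Probability/Distributions/`. Measure-theoretic bookkeeping for the proof of
Brascamp–Lieb 1976, Theorem 4.1 (`BrascampLieb1976_thm41`): the averages `⟨A⟩ = ∫ A F / ∫ F`
of (4.3) and their partial versions `⟨A⟩_z`, `⟨A⟩_y` of (4.4).

* Generic facts about the probability measure `μ_ρ = ρ dx / ∫ ρ` attached to a nonnegative
  integrable density `ρ` (written, as in `logConcaveMeasure`, as
  `(∫⁻ ρ)⁻¹ • volume.withDensity ρ`): it is a probability measure; `∫ φ dμ_ρ = ∫ ρ φ / ∫ ρ`;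
  integrability and `L²` membership in terms of `ρ φ`, `ρ φ²`; the variance.
* For `F = e^{-f}` on `ℝⁿ⁺¹ = ℝ × ℝⁿ`: the fiber measures `μ_y = ⟨·⟩_z` (the log-concave measure of
  `z ↦ f(y, z)`), the marginal `ν` on `ℝ` with density `Z(y) = ∫ F(y, z) dz`, the disintegration
  `∫ φ dμ_f = ∫ (∫ φ(y, ·) dμ_y) dν(y)` (Tonelli and Fubini forms), and the law of total variance
  `var h = ⟨var_z h⟩_y + var_y ⟨h⟩_z` used on p. 377 of the source.

Theorems only. References: H. J. Brascamp, E. H. Lieb, J. Funct. Anal. 22 (1976) 366–389, §4,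
(4.3)–(4.4) and p. 377. [BrascampLieb1976]
-/

noncomputable section

open MeasureTheory ProbabilityTheory Filter Set
open scoped ENNReal Topology

namespace Literature.Probability.Distributions

namespace BrascampLiebDensity

/-! ### The probability measure of a normalised density -/

section NormDens

variable {α : Type*} [MeasureSpace α] {ρ : α → ℝ} {μ : Measure α}

/-- `∫⁻ ρ = ofReal (∫ ρ)` for a nonnegative integrable density. [folklore] -/
theorem lintegral_ofReal_density (hρi : Integrable ρ) (hρ0 : ∀ x, 0 ≤ ρ x) :
    ∫⁻ x, ENNReal.ofReal (ρ x) = ENNReal.ofReal (∫ x, ρ x) :=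
  (ofReal_integral_eq_lintegral_ofReal hρi (ae_of_all _ hρ0)).symm

/-- `∫⁻ ρ ≠ 0` when `∫ ρ > 0`. [folklore] -/
theorem lintegral_density_ne_zero (hρi : Integrable ρ) (hρ0 : ∀ x, 0 ≤ ρ x) (hρp : 0 < ∫ x, ρ x) :
    ∫⁻ x, ENNReal.ofReal (ρ x) ≠ 0 := by
  rw [lintegral_ofReal_density hρi hρ0]
  exact (ENNReal.ofReal_pos.2 hρp).ne'

/-- `∫⁻ ρ ≠ ∞` for an integrable density. [folklore] -/
theorem lintegral_density_ne_top (hρi : Integrable ρ) (hρ0 : ∀ x, 0 ≤ ρ x) :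
    ∫⁻ x, ENNReal.ofReal (ρ x) ≠ ∞ := by
  rw [lintegral_ofReal_density hρi hρ0]
  exact ENNReal.ofReal_ne_top

/-- `ρ dx / ∫ ρ` is a probability measure. [folklore] -/
theorem isProbabilityMeasure_normDens (hρi : Integrable ρ) (hρ0 : ∀ x, 0 ≤ ρ x)
    (hρp : 0 < ∫ x, ρ x)
    (hμ : μ = (∫⁻ x, ENNReal.ofReal (ρ x))⁻¹ • volume.withDensity fun x => ENNReal.ofReal (ρ x)) :
    IsProbabilityMeasure μ := by
  constructor
  rw [hμ, Measure.smul_apply, withDensity_apply _ MeasurableSet.univ, Measure.restrict_univ,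
    smul_eq_mul, ENNReal.inv_mul_cancel (lintegral_density_ne_zero hρi hρ0 hρp)
      (lintegral_density_ne_top hρi hρ0)]

/-- `ρ dx / ∫ ρ ≪ dx`. [folklore] -/
theorem absolutelyContinuous_normDens
    (hμ : μ = (∫⁻ x, ENNReal.ofReal (ρ x))⁻¹ • volume.withDensity fun x => ENNReal.ofReal (ρ x)) :
    μ ≪ volume := by
  rw [hμ]
  exact (withDensity_absolutelyContinuous _ _).smul_left _

/-- **The average of (4.3)**: `∫ φ d(ρ dx / ∫ ρ) = ∫ ρ φ / ∫ ρ`. [cite: BrascampLieb1976, §4 eq. (4.3)] -/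
theorem integral_normDens (hρm : AEMeasurable ρ) (hρi : Integrable ρ) (hρ0 : ∀ x, 0 ≤ ρ x)
    (hρp : 0 < ∫ x, ρ x)
    (hμ : μ = (∫⁻ x, ENNReal.ofReal (ρ x))⁻¹ • volume.withDensity fun x => ENNReal.ofReal (ρ x))
    (φ : α → ℝ) :
    ∫ x, φ x ∂μ = (∫ x, ρ x * φ x) / ∫ x, ρ x := by
  rw [hμ, integral_smul_measure, integral_withDensity_eq_integral_toReal_smul₀ hρm.ennreal_ofReal
    (ae_of_all _ fun x => ENNReal.ofReal_lt_top)]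
  simp_rw [ENNReal.toReal_ofReal (hρ0 _), smul_eq_mul]
  rw [lintegral_ofReal_density hρi hρ0, ENNReal.toReal_inv, ENNReal.toReal_ofReal hρp.le,
    div_eq_inv_mul]

/-- Integrability under `ρ dx / ∫ ρ` is integrability of `ρ φ`. [folklore] -/
theorem integrable_normDens_iff (hρm : AEMeasurable ρ) (hρi : Integrable ρ) (hρ0 : ∀ x, 0 ≤ ρ x)
    (hρp : 0 < ∫ x, ρ x)
    (hμ : μ = (∫⁻ x, ENNReal.ofReal (ρ x))⁻¹ • volume.withDensity fun x => ENNReal.ofReal (ρ x))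
    {φ : α → ℝ} :
    Integrable φ μ ↔ Integrable fun x => ρ x * φ x := by
  rw [hμ, integrable_smul_measure (ENNReal.inv_ne_zero.2 (lintegral_density_ne_top hρi hρ0))
      (ENNReal.inv_ne_top.2 (lintegral_density_ne_zero hρi hρ0 hρp)),
    integrable_withDensity_iff_integrable_smul₀' hρm.ennreal_ofReal
      (ae_of_all _ fun x => ENNReal.ofReal_lt_top)]
  simp_rw [ENNReal.toReal_ofReal (hρ0 _), smul_eq_mul]

/-- Extended integrals under `ρ dx / ∫ ρ`. [folklore] -/
theorem lintegral_normDens (hρm : AEMeasurable ρ)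
    (hμ : μ = (∫⁻ x, ENNReal.ofReal (ρ x))⁻¹ • volume.withDensity fun x => ENNReal.ofReal (ρ x))
    {φ : α → ℝ≥0∞} (hφ : AEMeasurable φ) :
    ∫⁻ x, φ x ∂μ = (∫⁻ x, ENNReal.ofReal (ρ x))⁻¹ * ∫⁻ x, ENNReal.ofReal (ρ x) * φ x := by
  rw [hμ, lintegral_smul_measure, lintegral_withDensity_eq_lintegral_mul₀ hρm.ennreal_ofReal hφ]
  rfl

/-- `L²` membership under `ρ dx / ∫ ρ` is integrability of `ρ φ²`. [folklore] -/
theorem memLp_two_normDens_iff (hρm : AEMeasurable ρ) (hρi : Integrable ρ) (hρ0 : ∀ x, 0 ≤ ρ x)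
    (hρp : 0 < ∫ x, ρ x)
    (hμ : μ = (∫⁻ x, ENNReal.ofReal (ρ x))⁻¹ • volume.withDensity fun x => ENNReal.ofReal (ρ x))
    {φ : α → ℝ} (hφ : AEStronglyMeasurable φ μ) :
    MemLp φ 2 μ ↔ Integrable fun x => ρ x * φ x ^ 2 := by
  rw [memLp_two_iff_integrable_sq hφ, integrable_normDens_iff hρm hρi hρ0 hρp hμ]

/-- The variance under `ρ dx / ∫ ρ`: `var φ = ∫ ρ φ² / ∫ ρ - (∫ ρ φ / ∫ ρ)²`.
[cite: BrascampLieb1976, §4 eq. (4.3)] -/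
theorem variance_normDens (hρm : AEMeasurable ρ) (hρi : Integrable ρ) (hρ0 : ∀ x, 0 ≤ ρ x)
    (hρp : 0 < ∫ x, ρ x)
    (hμ : μ = (∫⁻ x, ENNReal.ofReal (ρ x))⁻¹ • volume.withDensity fun x => ENNReal.ofReal (ρ x))
    {φ : α → ℝ} (hφ : MemLp φ 2 μ) :
    variance φ μ = (∫ x, ρ x * φ x ^ 2) / (∫ x, ρ x) - ((∫ x, ρ x * φ x) / ∫ x, ρ x) ^ 2 := by
  haveI := isProbabilityMeasure_normDens hρi hρ0 hρp hμ
  rw [variance_eq_sub hφ, integral_normDens hρm hρi hρ0 hρp hμ, integral_normDens hρm hρi hρ0 hρp hμ]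
  rfl

end NormDens

/-! ### Fibers and marginal of `e^{-f} dx / ∫ e^{-f}` along the first coordinate -/

section Disintegration

open BrascampLiebCalculus

variable {n : ℕ} {f : (Fin (n + 1) → ℝ) → ℝ}

/-- The fiber partition functions `Z(y) = ∫ e^{-f(y,z)} dz` are positive. [folklore] -/
theorem fiberZ_pos (hfib : ∀ y, Integrable fun z : Fin n → ℝ => Real.exp (-f (Fin.cons y z)))
    (y : ℝ) : 0 < ∫ z : Fin n → ℝ, Real.exp (-f (Fin.cons y z)) := by
  refine (integral_pos_iff_support_of_nonneg (fun _ => (Real.exp_pos _).le) (hfib y)).2 ?_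
  have : Function.support (fun z : Fin n → ℝ => Real.exp (-f (Fin.cons y z))) = univ := by
    ext z; simp [(Real.exp_pos _).ne']
  rw [this]
  -- volume of `univ` in `ℝⁿ` is positive (it is `∞` for `n ≥ 1`, `1` for `n = 0`)
  exact Measure.measure_univ_pos.2 (NeZero.ne _)

/-- The fiber partition function `y ↦ Z(y)` is measurable. [folklore] -/
theorem measurable_fiberZ (hf : Continuous f) :
    Measurable fun y : ℝ => ∫ z : Fin n → ℝ, Real.exp (-f (Fin.cons y z)) := by
  have hc : Continuous fun p : ℝ × (Fin n → ℝ) => (Fin.cons p.1 p.2 : Fin (n + 1) → ℝ) := by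
    fun_prop
  have hG : StronglyMeasurable fun p : ℝ × (Fin n → ℝ) => Real.exp (-f (Fin.cons p.1 p.2)) :=
    (Real.continuous_exp.comp (hf.comp hc).neg).stronglyMeasurable
  exact (hG.integral_prod_right' (ν := volume)).measurable

/-- `Z(y) = ∫ e^{-f(y,z)} dz` as an extended integral. [folklore] -/
theorem ofReal_fiberZ (hfib : ∀ y, Integrable fun z : Fin n → ℝ => Real.exp (-f (Fin.cons y z)))
    (y : ℝ) :
    ENNReal.ofReal (∫ z : Fin n → ℝ, Real.exp (-f (Fin.cons y z))) =
      ∫⁻ z : Fin n → ℝ, ENNReal.ofReal (Real.exp (-f (Fin.cons y z))) :=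
  (lintegral_ofReal_density (hfib y) fun _ => (Real.exp_pos _).le).symm

/-- `∫ Z(y) dy = ∫ e^{-f}` (Fubini). [folklore] -/
theorem integral_fiberZ (hint : Integrable fun x => Real.exp (-f x)) :
    ∫ y : ℝ, ∫ z : Fin n → ℝ, Real.exp (-f (Fin.cons y z)) = ∫ x, Real.exp (-f x) :=
  (integral_eq_integral_cons hint).symm

/-- `y ↦ Z(y)` is integrable. [folklore] -/
theorem integrable_fiberZ (hint : Integrable fun x => Real.exp (-f x)) :
    Integrable fun y : ℝ => ∫ z : Fin n → ℝ, Real.exp (-f (Fin.cons y z)) :=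
  integrable_integral_cons hint

/-- `∫ Z(y) dy > 0`. [folklore] -/
theorem integral_fiberZ_pos (hint : Integrable fun x => Real.exp (-f x)) :
    0 < ∫ y : ℝ, ∫ z : Fin n → ℝ, Real.exp (-f (Fin.cons y z)) := by
  rw [integral_fiberZ hint]
  refine (integral_pos_iff_support_of_nonneg (fun _ => (Real.exp_pos _).le) hint).2 ?_
  have : Function.support (fun x : Fin (n + 1) → ℝ => Real.exp (-f x)) = univ := by
    ext x; simp [(Real.exp_pos _).ne']
  rw [this]
  exact Measure.measure_univ_pos.2 (NeZero.ne _)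

/-- `∫⁻ Z = ∫⁻ e^{-f}` (Tonelli). [folklore] -/
theorem lintegral_fiberZ (hf : Continuous f)
    (hfib : ∀ y, Integrable fun z : Fin n → ℝ => Real.exp (-f (Fin.cons y z))) :
    ∫⁻ y : ℝ, ENNReal.ofReal (∫ z : Fin n → ℝ, Real.exp (-f (Fin.cons y z))) =
      ∫⁻ x, ENNReal.ofReal (Real.exp (-f x)) := by
  simp_rw [ofReal_fiberZ hfib]
  exact (lintegral_eq_lintegral_cons (φ := fun x => ENNReal.ofReal (Real.exp (-f x)))
    (by fun_prop)).symm

/-- **Disintegration of `⟨·⟩` along the first coordinate, Tonelli form**: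
`∫ φ dμ_f = ∫ (∫ φ(y, z) dμ_y(z)) dν(y)` for measurable `φ ≥ 0`, where `μ_y` is the log-concave
probability measure of the fiber `z ↦ f(y, z)` and `ν = Z(y) dy / ∫ Z` is the marginal.
[cite: BrascampLieb1976, §4 eq. (4.4)] -/
theorem lintegral_logConcaveMeasure_eq (hf : Continuous f)
    (hfib : ∀ y, Integrable fun z : Fin n → ℝ => Real.exp (-f (Fin.cons y z)))
    {μy : ℝ → Measure (Fin n → ℝ)} (hμy : ∀ y, μy y = logConcaveMeasure fun z => f (Fin.cons y z))
    {ν : Measure ℝ}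
    (hν : ν = (∫⁻ y, ENNReal.ofReal (∫ z : Fin n → ℝ, Real.exp (-f (Fin.cons y z))))⁻¹ •
      volume.withDensity fun y => ENNReal.ofReal (∫ z : Fin n → ℝ, Real.exp (-f (Fin.cons y z))))
    {φ : (Fin (n + 1) → ℝ) → ℝ≥0∞} (hφ : Measurable φ) :
    ∫⁻ x, φ x ∂(logConcaveMeasure f) = ∫⁻ y, (∫⁻ z, φ (Fin.cons y z) ∂(μy y)) ∂ν := by
  have hc : Continuous fun p : ℝ × (Fin n → ℝ) => (Fin.cons p.1 p.2 : Fin (n + 1) → ℝ) := by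
    fun_prop
  -- the integrand `(y, z) ↦ e^{-f(y,z)} φ(y,z)` and its fiber integrals
  set G : ℝ → ℝ≥0∞ := fun y => ∫⁻ z : Fin n → ℝ,
    ENNReal.ofReal (Real.exp (-f (Fin.cons y z))) * φ (Fin.cons y z) with hG
  have hGm : Measurable G := by
    refine Measurable.lintegral_prod_right' (f := fun p : ℝ × (Fin n → ℝ) =>
      ENNReal.ofReal (Real.exp (-f (Fin.cons p.1 p.2))) * φ (Fin.cons p.1 p.2)) ?_
    exact ((by fun_prop : Measurable fun p : ℝ × (Fin n → ℝ) =>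
      ENNReal.ofReal (Real.exp (-f (Fin.cons p.1 p.2))))).mul (hφ.comp hc.measurable)
  set L : ℝ → ℝ≥0∞ := fun y => ∫⁻ z : Fin n → ℝ, ENNReal.ofReal (Real.exp (-f (Fin.cons y z)))
    with hL
  have hLm : Measurable L :=
    Measurable.lintegral_prod_right' (f := fun p : ℝ × (Fin n → ℝ) =>
      ENNReal.ofReal (Real.exp (-f (Fin.cons p.1 p.2)))) (by fun_prop)
  have hL0 : ∀ y, L y ≠ 0 := fun y =>
    lintegral_density_ne_zero (hfib y) (fun _ => (Real.exp_pos _).le) (fiberZ_pos hfib y)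
  have hLt : ∀ y, L y ≠ ∞ := fun y =>
    lintegral_density_ne_top (hfib y) (fun _ => (Real.exp_pos _).le)
  -- left side
  have lhs : ∫⁻ x, φ x ∂(logConcaveMeasure f) =
      (∫⁻ x, ENNReal.ofReal (Real.exp (-f x)))⁻¹ * ∫⁻ y, G y := by
    rw [lintegral_normDens (μ := logConcaveMeasure f) (ρ := fun x => Real.exp (-f x)) (by fun_prop) rfl
        hφ.aemeasurable,
      lintegral_eq_lintegral_cons (φ := fun x => ENNReal.ofReal (Real.exp (-f x)) * φ x)
        (((by fun_prop : Measurable fun x => ENNReal.ofReal (Real.exp (-f x)))).mul hφ)]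
  -- inner integrals
  have inner : ∀ y, ∫⁻ z, φ (Fin.cons y z) ∂(μy y) = (L y)⁻¹ * G y := by
    intro y
    rw [hμy y]
    exact lintegral_normDens (ρ := fun z => Real.exp (-f (Fin.cons y z))) (by fun_prop) rfl
      (hφ.comp (by fun_prop : Continuous fun z : Fin n → ℝ =>
        (Fin.cons y z : Fin (n + 1) → ℝ)).measurable).aemeasurable
  simp_rw [inner]
  rw [lintegral_normDens (μ := ν) (ρ := fun y => ∫ z : Fin n → ℝ, Real.exp (-f (Fin.cons y z)))
      (φ := fun y => (L y)⁻¹ * G y) (measurable_fiberZ hf).aemeasurable hν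
      (hLm.inv.mul hGm).aemeasurable,
    lintegral_fiberZ hf hfib, lhs]
  congr 1
  refine lintegral_congr fun y => ?_
  rw [ofReal_fiberZ hfib, ← mul_assoc, ENNReal.mul_inv_cancel (hL0 y) (hLt y), one_mul]

/-- Fiber averages: `∫ φ(y, ·) dμ_y = ∫ e^{-f(y,z)} φ(y,z) dz / Z(y)`. [cite: BrascampLieb1976, §4 eq. (4.4)] -/
theorem integral_fiber_eq (hf : Continuous f)
    (hfib : ∀ y, Integrable fun z : Fin n → ℝ => Real.exp (-f (Fin.cons y z)))
    {μy : ℝ → Measure (Fin n → ℝ)} (hμy : ∀ y, μy y = logConcaveMeasure fun z => f (Fin.cons y z))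
    (φ : (Fin (n + 1) → ℝ) → ℝ) (y : ℝ) :
    ∫ z, φ (Fin.cons y z) ∂(μy y) =
      (∫ z : Fin n → ℝ, Real.exp (-f (Fin.cons y z)) * φ (Fin.cons y z)) /
        ∫ z : Fin n → ℝ, Real.exp (-f (Fin.cons y z)) := by
  rw [hμy y]
  exact integral_normDens (ρ := fun z => Real.exp (-f (Fin.cons y z))) (by fun_prop) (hfib y)
    (fun _ => (Real.exp_pos _).le) (fiberZ_pos hfib y) rfl _

/-- The fiber averages `y ↦ ∫ φ(y, ·) dμ_y` of a `μ_f`-integrable `φ` are `ν`-integrable.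
[folklore] -/
theorem integrable_integral_fiber (hf : Continuous f) (hint : Integrable fun x => Real.exp (-f x))
    (hfib : ∀ y, Integrable fun z : Fin n → ℝ => Real.exp (-f (Fin.cons y z)))
    {μy : ℝ → Measure (Fin n → ℝ)} (hμy : ∀ y, μy y = logConcaveMeasure fun z => f (Fin.cons y z))
    {ν : Measure ℝ}
    (hν : ν = (∫⁻ y, ENNReal.ofReal (∫ z : Fin n → ℝ, Real.exp (-f (Fin.cons y z))))⁻¹ •
      volume.withDensity fun y => ENNReal.ofReal (∫ z : Fin n → ℝ, Real.exp (-f (Fin.cons y z))))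
    {φ : (Fin (n + 1) → ℝ) → ℝ} (hφi : Integrable fun x => Real.exp (-f x) * φ x) :
    Integrable (fun y => ∫ z, φ (Fin.cons y z) ∂(μy y)) ν := by
  rw [integrable_normDens_iff (μ := ν) (measurable_fiberZ hf).aemeasurable (integrable_fiberZ hint)
    (fun _ => integral_nonneg fun _ => (Real.exp_pos _).le) (integral_fiberZ_pos hint) hν]
  have e : (fun y => (∫ z : Fin n → ℝ, Real.exp (-f (Fin.cons y z))) * ∫ z, φ (Fin.cons y z) ∂(μy y))
      = fun y => ∫ z : Fin n → ℝ, Real.exp (-f (Fin.cons y z)) * φ (Fin.cons y z) := by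
    funext y
    rw [integral_fiber_eq hf hfib hμy φ y, mul_div_cancel₀ _ (fiberZ_pos hfib y).ne']
  rw [e]
  exact integrable_integral_cons (φ := fun x => Real.exp (-f x) * φ x) hφi

/-- **Disintegration of `⟨·⟩` along the first coordinate, Fubini form**:
`∫ φ dμ_f = ∫ (∫ φ(y, ·) dμ_y) dν(y)` for `φ` with `e^{-f} φ` integrable.
[cite: BrascampLieb1976, §4 eq. (4.4)] -/
theorem integral_logConcaveMeasure_eq (hf : Continuous f) (hint : Integrable fun x => Real.exp (-f x))
    (hfib : ∀ y, Integrable fun z : Fin n → ℝ => Real.exp (-f (Fin.cons y z)))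
    {μy : ℝ → Measure (Fin n → ℝ)} (hμy : ∀ y, μy y = logConcaveMeasure fun z => f (Fin.cons y z))
    {ν : Measure ℝ}
    (hν : ν = (∫⁻ y, ENNReal.ofReal (∫ z : Fin n → ℝ, Real.exp (-f (Fin.cons y z))))⁻¹ •
      volume.withDensity fun y => ENNReal.ofReal (∫ z : Fin n → ℝ, Real.exp (-f (Fin.cons y z))))
    {φ : (Fin (n + 1) → ℝ) → ℝ} (hφi : Integrable fun x => Real.exp (-f x) * φ x) :
    ∫ x, φ x ∂(logConcaveMeasure f) = ∫ y, (∫ z, φ (Fin.cons y z) ∂(μy y)) ∂ν := by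
  have hZpos := integral_fiberZ_pos hint (n := n)
  rw [integral_normDens (μ := logConcaveMeasure f) (ρ := fun x => Real.exp (-f x)) (by fun_prop) hint
      (fun _ => (Real.exp_pos _).le) (by rwa [integral_fiberZ hint] at hZpos) rfl,
    integral_normDens (μ := ν) (measurable_fiberZ hf).aemeasurable (integrable_fiberZ hint)
      (fun _ => integral_nonneg fun _ => (Real.exp_pos _).le) hZpos hν,
    integral_fiberZ hint, integral_eq_integral_cons hφi]
  congr 1
  refine integral_congr_ae (ae_of_all _ fun y => ?_)
  simp only
  rw [integral_fiber_eq hf hfib hμy φ y, mul_div_cancel₀ _ (fiberZ_pos hfib y).ne']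

/-- Fibers of `μ_f` are probability measures. [folklore] -/
theorem isProbabilityMeasure_fiber
    (hfib : ∀ y, Integrable fun z : Fin n → ℝ => Real.exp (-f (Fin.cons y z)))
    {μy : ℝ → Measure (Fin n → ℝ)} (hμy : ∀ y, μy y = logConcaveMeasure fun z => f (Fin.cons y z))
    (y : ℝ) : IsProbabilityMeasure (μy y) :=
  isProbabilityMeasure_normDens (ρ := fun z => Real.exp (-f (Fin.cons y z))) (hfib y)
    (fun _ => (Real.exp_pos _).le) (fiberZ_pos hfib y) (hμy y)

/-- The marginal `ν` is a probability measure. [folklore] -/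
theorem isProbabilityMeasure_marginal (hint : Integrable fun x => Real.exp (-f x))
    {ν : Measure ℝ}
    (hν : ν = (∫⁻ y, ENNReal.ofReal (∫ z : Fin n → ℝ, Real.exp (-f (Fin.cons y z))))⁻¹ •
      volume.withDensity fun y => ENNReal.ofReal (∫ z : Fin n → ℝ, Real.exp (-f (Fin.cons y z)))) :
    IsProbabilityMeasure ν :=
  isProbabilityMeasure_normDens (integrable_fiberZ hint)
    (fun _ => integral_nonneg fun _ => (Real.exp_pos _).le) (integral_fiberZ_pos hint) hν

/-- `μ_f` is a probability measure (when `e^{-f}` is integrable). [folklore] -/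
theorem isProbabilityMeasure_logConcaveMeasure {m : ℕ} {g : (Fin m → ℝ) → ℝ}
    (hint : Integrable fun x => Real.exp (-g x)) : IsProbabilityMeasure (logConcaveMeasure g) := by
  refine isProbabilityMeasure_normDens (ρ := fun x => Real.exp (-g x)) hint
    (fun _ => (Real.exp_pos _).le) ?_ rfl
  refine (integral_pos_iff_support_of_nonneg (fun _ => (Real.exp_pos _).le) hint).2 ?_
  have : Function.support (fun x : Fin m → ℝ => Real.exp (-g x)) = univ := by
    ext x; simp [(Real.exp_pos _).ne']
  rw [this]
  exact Measure.measure_univ_pos.2 (NeZero.ne _)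

/-- `e^{-f} |h|` is integrable once `e^{-f}` and `e^{-f} h²` are. [folklore] -/
theorem integrable_mul_of_sq {α : Type*} [MeasureSpace α] {ρ h : α → ℝ} (hρ : Integrable ρ)
    (hρ0 : ∀ x, 0 ≤ ρ x) (hh : AEStronglyMeasurable h) (h2 : Integrable fun x => ρ x * h x ^ 2) :
    Integrable fun x => ρ x * h x := by
  refine (hρ.add h2).mono' (hρ.1.mul hh) (ae_of_all _ fun x => ?_)
  rw [Real.norm_eq_abs, abs_mul, abs_of_nonneg (hρ0 x)]
  have : |h x| ≤ 1 + h x ^ 2 := by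
    rcases le_or_gt 1 |h x| with h1 | h1
    · calc |h x| ≤ |h x| * |h x| := le_mul_of_one_le_left (abs_nonneg _) h1
        _ = h x ^ 2 := by rw [← sq, sq_abs]
        _ ≤ 1 + h x ^ 2 := by linarith
    · linarith [sq_nonneg (h x)]
  calc ρ x * |h x| ≤ ρ x * (1 + h x ^ 2) := mul_le_mul_of_nonneg_left this (hρ0 x)
    _ = ρ x + ρ x * h x ^ 2 := by ring

/-- **The law of total variance along the first coordinate** (Brascamp–Lieb p. 377:
`var h = ⟨var_z h⟩_y + var_y(⟨h⟩_z)`), for continuous `h` with `e^{-f} h² ∈ L¹` globally and on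
every fiber: the three assertions are the integrability of the fiber variances for `ν`, the `L²(ν)`
membership of the fiber means `H(y) = ⟨h⟩_z(y)`, and the identity itself.
[cite: BrascampLieb1976, Thm 4.1 (proof, p. 377)] -/
theorem variance_decomposition (hf : Continuous f) (hint : Integrable fun x => Real.exp (-f x))
    (hfib : ∀ y, Integrable fun z : Fin n → ℝ => Real.exp (-f (Fin.cons y z)))
    {μy : ℝ → Measure (Fin n → ℝ)} (hμy : ∀ y, μy y = logConcaveMeasure fun z => f (Fin.cons y z))
    {ν : Measure ℝ}
    (hν : ν = (∫⁻ y, ENNReal.ofReal (∫ z : Fin n → ℝ, Real.exp (-f (Fin.cons y z))))⁻¹ •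
      volume.withDensity fun y => ENNReal.ofReal (∫ z : Fin n → ℝ, Real.exp (-f (Fin.cons y z))))
    {h : (Fin (n + 1) → ℝ) → ℝ} (hh : Continuous h)
    (h2 : Integrable fun x => Real.exp (-f x) * h x ^ 2)
    (h2f : ∀ y, Integrable fun z : Fin n → ℝ => Real.exp (-f (Fin.cons y z)) * h (Fin.cons y z) ^ 2) :
    Integrable (fun y => variance (fun z => h (Fin.cons y z)) (μy y)) ν ∧
    MemLp (fun y => ∫ z, h (Fin.cons y z) ∂(μy y)) 2 ν ∧
    variance h (logConcaveMeasure f) =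
      (∫ y, variance (fun z => h (Fin.cons y z)) (μy y) ∂ν) +
        variance (fun y => ∫ z, h (Fin.cons y z) ∂(μy y)) ν := by
  have hcy : ∀ y, Continuous fun z : Fin n → ℝ => (Fin.cons y z : Fin (n + 1) → ℝ) := fun y => by
    fun_prop
  haveI hPf := isProbabilityMeasure_logConcaveMeasure hint
  haveI hPy : ∀ y, IsProbabilityMeasure (μy y) := isProbabilityMeasure_fiber hfib hμy
  haveI hPν := isProbabilityMeasure_marginal hint hν
  -- integrability of `e^{-f} h` globally and on fibers
  have h1 : Integrable fun x => Real.exp (-f x) * h x :=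
    integrable_mul_of_sq hint (fun _ => (Real.exp_pos _).le) hh.aestronglyMeasurable h2
  have h1f : ∀ y, Integrable fun z : Fin n → ℝ => Real.exp (-f (Fin.cons y z)) * h (Fin.cons y z) :=
    fun y => integrable_mul_of_sq (hfib y) (fun _ => (Real.exp_pos _).le)
      (hh.comp (hcy y)).aestronglyMeasurable (h2f y)
  -- `L²` memberships
  have hmem : MemLp h 2 (logConcaveMeasure f) :=
    (memLp_two_normDens_iff (ρ := fun x => Real.exp (-f x)) (by fun_prop) hint
      (fun _ => (Real.exp_pos _).le)
      ((integral_pos_iff_support_of_nonneg (fun _ => (Real.exp_pos _).le) hint).2 (by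
        have : Function.support (fun x : Fin (n + 1) → ℝ => Real.exp (-f x)) = univ := by
          ext x; simp [(Real.exp_pos _).ne']
        rw [this]; exact Measure.measure_univ_pos.2 (NeZero.ne _))) rfl
      hh.aestronglyMeasurable).2 h2
  have hmemy : ∀ y, MemLp (fun z => h (Fin.cons y z)) 2 (μy y) := fun y =>
    (memLp_two_normDens_iff (ρ := fun z => Real.exp (-f (Fin.cons y z))) (by fun_prop) (hfib y)
      (fun _ => (Real.exp_pos _).le) (fiberZ_pos hfib y) (hμy y)
      (hh.comp (hcy y)).aestronglyMeasurable).2 (h2f y)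
  -- notation
  set E2 : ℝ → ℝ := fun y => ∫ z, h (Fin.cons y z) ^ 2 ∂(μy y) with hE2
  set H : ℝ → ℝ := fun y => ∫ z, h (Fin.cons y z) ∂(μy y) with hH
  set V : ℝ → ℝ := fun y => variance (fun z => h (Fin.cons y z)) (μy y) with hV
  have hVeq : ∀ y, V y = E2 y - H y ^ 2 := fun y => by
    simp only [hV, hE2, hH]
    rw [variance_eq_sub (hmemy y)]
    rfl
  have hE2i : Integrable E2 ν :=
    integrable_integral_fiber hf hint hfib hμy hν (φ := fun x => h x ^ 2) h2
  have hHi : Integrable H ν := integrable_integral_fiber hf hint hfib hμy hν (φ := h) h1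
  have hH2le : ∀ y, H y ^ 2 ≤ E2 y := fun y => by
    have := variance_nonneg (fun z => h (Fin.cons y z)) (μy y)
    rw [show variance (fun z => h (Fin.cons y z)) (μy y) = V y from rfl, hVeq y] at this
    linarith
  have hH2i : Integrable (fun y => H y ^ 2) ν := by
    refine hE2i.mono' (hHi.1.pow 2) (ae_of_all _ fun y => ?_)
    rw [Real.norm_eq_abs, abs_of_nonneg (sq_nonneg _)]
    exact hH2le y
  have hHmem : MemLp H 2 ν := (memLp_two_iff_integrable_sq hHi.1).2 hH2i
  have hVi : Integrable V ν := by
    have e : V = fun y => E2 y - H y ^ 2 := funext hVeq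
    rw [e]
    exact hE2i.sub hH2i
  refine ⟨hVi, hHmem, ?_⟩
  -- the identity
  have eh2 : ∫ x, h x ^ 2 ∂(logConcaveMeasure f) = ∫ y, E2 y ∂ν :=
    integral_logConcaveMeasure_eq hf hint hfib hμy hν (φ := fun x => h x ^ 2) h2
  have eh1 : ∫ x, h x ∂(logConcaveMeasure f) = ∫ y, H y ∂ν :=
    integral_logConcaveMeasure_eq hf hint hfib hμy hν (φ := h) h1
  have eV : ∫ y, V y ∂ν = (∫ y, E2 y ∂ν) - ∫ y, H y ^ 2 ∂ν := by
    rw [← integral_sub hE2i hH2i]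
    exact integral_congr_ae (ae_of_all _ hVeq)
  rw [variance_eq_sub hmem, variance_eq_sub hHmem]
  simp only [Pi.pow_apply]
  rw [eh2, eh1, eV]
  ring

end Disintegration

end BrascampLiebDensity

end Literature.Probability.Distributions
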